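import Summits.Schanuel.Schanuel.Theorems.RootDecomp1KHyper05

/-!
# RootDecomp1KHyperDense — hyper-Liouville reals are DENSE (Baire); the cells of A₄ʰ are not vacuous

Port (census-1 gen 9) of §16e of lens 6's gen-9 node «HyperCarving» = HOME/decomp-schanuel-lens-6/g9/HyperCarving.lean
(ll. 4454–4548; statements and proofs verbatim), asked for by the critic (VERDICT 2026-08-30T18:23:36Z, port note h9:
«land `dense_setOf_hyperLiouville` … the tree cites it (RootDecomp1KHyper12) but does not have it; then a one-line corollary
`∃ ρ : ℝ, 0 < ρ ∧ HyperLiouville ρ` makes the showpiece visibly non-vacuous in the tree»). `--supports stmt-Schanuel-33363`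
(A₄ʰ `HyperLiouvilleSchanuel`: every decided cell of the 1K series — torsion / Kummer / radical / π-cells — quantifies over
hyper-Liouville reals `ρ`, here shown to form a dense, hence non-empty, set with positive members).
Namespace `Summit.Schanuel.Schanuel.Theorems.RootDecomp1KHyper.HyperCell` (where `HyperLiouville` lives, RootDecomp1KHyper05).
Sorry-free; standard axioms. Nothing here proves Schanuel; rung 0.
-/

noncomputable section

open Complex

namespace Summit.Schanuel.Schanuel.Theorems.RootDecomp1KHyper

namespace HyperCell


/-- Rationals with denominator `≥ m` are dense. -/
theorem exists_rat_den_ge_near (x : ℝ) {ε : ℝ} (hε : 0 < ε) (m : ℕ) :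
    ∃ r : ℚ, m ≤ r.den ∧ |x - r| < ε := by
  obtain ⟨p, hp, hprime⟩ := Nat.exists_infinite_primes (max m (⌈1 / ε⌉₊ + 1))
  have hpm : m ≤ p := le_trans (le_max_left _ _) hp
  have hpε : 1 / ε < p := by
    have h1 : (⌈1 / ε⌉₊ : ℝ) + 1 ≤ p := by exact_mod_cast le_trans (le_max_right _ _) hp
    linarith [Nat.le_ceil (1 / ε)]
  have hp0 : (0 : ℝ) < p := by exact_mod_cast hprime.pos
  have hpinv : 1 / (p : ℝ) < ε := by
    rw [div_lt_iff₀ hp0]; rw [div_lt_iff₀ hε] at hpε; linarith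
  set k₀ : ℤ := ⌊x * p⌋ with hk₀
  -- one of k₀, k₀ + 1 is prime to p
  have hk : ∃ k : ℤ, (k = k₀ ∨ k = k₀ + 1) ∧ ¬ (p : ℤ) ∣ k := by
    by_cases h0 : (p : ℤ) ∣ k₀
    · refine ⟨k₀ + 1, Or.inr rfl, fun h1 => ?_⟩
      have : (p : ℤ) ∣ 1 := by simpa using dvd_sub h1 h0
      have := Int.eq_one_of_dvd_one (by positivity) this
      have := hprime.one_lt
      omega
    · exact ⟨k₀, Or.inl rfl, h0⟩
  obtain ⟨k, hk01, hkp⟩ := hk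
  refine ⟨(k : ℚ) / p, ?_, ?_⟩
  · -- denominator = p
    have hcop : Nat.Coprime k.natAbs (p : ℤ).natAbs := by
      rw [Int.natAbs_natCast]
      exact Nat.coprime_comm.mp ((Nat.Prime.coprime_iff_not_dvd hprime).mpr
        (fun h => hkp (Int.natCast_dvd.mpr h)))
    have hden := Rat.den_div_eq_of_coprime (a := k) (b := (p : ℤ)) (by exact_mod_cast hprime.pos) hcop
    have : ((k : ℚ) / p).den = p := by exact_mod_cast hden
    rw [this]
    exact hpm
  · have hcast : (((k : ℚ) / p : ℚ) : ℝ) = (k : ℝ) / p := by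
      rw [Rat.cast_div, Rat.cast_intCast, Rat.cast_natCast]
    rw [hcast]
    have hfl : (k₀ : ℝ) ≤ x * p := Int.floor_le _
    have hfl' : x * p < k₀ + 1 := Int.lt_floor_add_one _
    have hlo : (k₀ : ℝ) / p ≤ x := by rw [div_le_iff₀ hp0]; exact hfl
    have hhi : x < ((k₀ : ℝ) + 1) / p := by rw [lt_div_iff₀ hp0]; exact hfl'
    have hgap : ((k₀ : ℝ) + 1) / p - k₀ / p = 1 / p := by
      rw [← sub_div, add_sub_cancel_left]
    rcases hk01 with rfl | rfl
    · rw [abs_of_nonneg (by linarith)]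
      linarith
    · push_cast
      rw [abs_of_nonpos (by linarith)]
      linarith

open Topology in
/-- **Hyper-Liouville reals are dense** (Baire: `⋂_m ⋃_{den r ≥ m} B(r, e^{−den^m}) ∖ {r}` is a
dense `G_δ`); in particular they exist, and the cells of §16e are not vacuous. -/
theorem dense_setOf_hyperLiouville : Dense {ρ : ℝ | HyperLiouville ρ} := by
  let U : ℕ → Set ℝ := fun m => ⋃ r : {r : ℚ // m ≤ r.den},
    Metric.ball ((r : ℚ) : ℝ) (Real.exp (-(((r : ℚ).den : ℝ) ^ m))) \ {((r : ℚ) : ℝ)}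
  have hsub : (⋂ m, U m) ⊆ {ρ : ℝ | HyperLiouville ρ} := by
    intro ρ hρ m
    have hm := Set.mem_iInter.mp hρ m
    obtain ⟨⟨r, hr⟩, hmem⟩ := Set.mem_iUnion.mp hm
    refine ⟨r, hr, fun h => hmem.2 (by simpa using h), ?_⟩
    have := hmem.1
    rw [Metric.mem_ball, Real.dist_eq] at this
    exact this
  refine Dense.mono hsub (dense_iInter_of_isOpen (fun m => ?_) (fun m => ?_))
  · exact isOpen_iUnion fun r => Metric.isOpen_ball.sdiff isClosed_singleton
  · rw [Metric.dense_iff]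
    intro x ε hε
    obtain ⟨r, hr, hxr⟩ := exists_rat_den_ge_near x (half_pos hε) m
    set t : ℝ := min (Real.exp (-((r.den : ℝ) ^ m))) ε / 2 with ht
    have ht0 : 0 < t := by positivity
    have hte : t < Real.exp (-((r.den : ℝ) ^ m)) := by
      have := min_le_left (Real.exp (-((r.den : ℝ) ^ m))) ε
      have := Real.exp_pos (-((r.den : ℝ) ^ m))
      rw [ht]; linarith
    have htε : t ≤ ε / 2 := by
      have := min_le_right (Real.exp (-((r.den : ℝ) ^ m))) ε
      rw [ht]; linarith
    refine ⟨(r : ℝ) + t, ?_, ?_⟩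
    · rw [Metric.mem_ball, Real.dist_eq]
      calc |(r : ℝ) + t - x| = |t + (r - x)| := by ring_nf
        _ ≤ |t| + |(r : ℝ) - x| := abs_add_le _ _
        _ < ε / 2 + ε / 2 := by
            rw [abs_of_pos ht0, abs_sub_comm]
            exact add_lt_add_of_le_of_lt htε hxr
        _ = ε := by ring
    · refine Set.mem_iUnion.mpr ⟨⟨r, hr⟩, ?_, ?_⟩
      · rw [Metric.mem_ball, Real.dist_eq]
        simpa [abs_of_pos ht0] using hte
      · simp only [Set.mem_singleton_iff]
        intro h
        have : t = 0 := by linarith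
        exact ht0.ne' this

/-- Hyper-Liouville reals exist (the dense set is non-empty). -/
theorem exists_hyperLiouville : ∃ ρ : ℝ, HyperLiouville ρ :=
  dense_setOf_hyperLiouville.nonempty

/-- **Non-vacuity of the 1K cells**: there is a POSITIVE hyper-Liouville real (density meets the open half-line). -/
theorem exists_pos_hyperLiouville : ∃ ρ : ℝ, 0 < ρ ∧ HyperLiouville ρ := by
  obtain ⟨ρ, hρ, hρpos⟩ := dense_setOf_hyperLiouville.exists_mem_open isOpen_Ioi ⟨1, Set.mem_Ioi.mpr one_pos⟩
  exact ⟨ρ, Set.mem_Ioi.mp hρpos, hρ⟩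

end HyperCell

end Summit.Schanuel.Schanuel.Theorems.RootDecomp1KHyper
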